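import Summits.Ventures.HSemireg.ObstructionLocusCrossingCore
import Summits.Ventures.HSemireg.ObstructionLocusCrossingDoubleCokernel

/-!
# Venture HSemireg — (S5) OBSTRUCTION LOCUS away from secant type, XXXIX: `T`-FREE REPRESENTATIVES modulo the ideal of
# a set of variables `J = (x_t : t ∈ T)`, non-zero-divisors modulo `J`, and the injectivity of a block's Hilbert–Burch
# matrix on vectors with values in a module with injective `x_a`-action (tools for EXT-NOTE §6.B(c) in a middle degree)

HONEST FRAMING.  Part of the Lean side of the computation cell `pub-hsemireg` (track «S4-PUSH» (ii), seat
s4-prove-2).  Plain commutative algebra in `R = MvPolynomial (Fin n) K`, every `n`, EVERY commutative ring `K`.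
Nothing here constructs a variety or a sheaf; nothing here says that HC / HC_CM / HC_AV holds; no Literature fact is
declared or used; no object is certified.

CONTENT.  For a finite set of coordinates `T ⊆ [n]` let `J = varIdeal K T = (x_t : t ∈ T)` and `R̄ = R ⧸ J`.
* `Touches T e` ∕ `tfreePart T p` (delete the monomials touching `T`; the analogue of file XV's `stdPart`):
  `coeff_tfreePart`, `tfreePart_sub_mem`, `mk_tfreePart`, `exists_tfree_rep`, **`eq_zero_of_tfree_of_mem`** (a `T`-free
  element of `J` is `0`), closure of `T`-freeness under `+`, `−`, `*`, finite sums, monomials, `x_b` (`b ∉ T`), `x_U`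
  (`U ∩ T = ∅`);
* non-zero-divisors: **`sq_mul_mem_varIdeal_iff`** (`x_U p ∈ J ⟺ p ∈ J` for `U ∩ T = ∅`), `sq_smul_quot_injective`,
  `X_smul_quot_injective`;
* **`scalarMatrix_hbMatrix_injective_of_smul_injective`**: the Hilbert–Burch matrix `Φ` of a block `S` (file XXXII's
  `hbMatrix`) is injective on `M`-valued vectors as soon as every `x_a`, `a ∈ S ∖ a₀`, acts injectively on `M`;
  `X_smul_pi_injective` (products).
References (dictionary only): EXT-NOTE.md §6.A, §6.B(c).
-/
open MvPolynomial Finset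
open scoped BigOperators

universe u

namespace Summit.Ventures.HSemireg.ObstructionLocus.BlockModel

variable {K : Type u} [CommRing K] {n : ℕ}

/-! ## The ideal of a set of variables and `T`-free polynomials -/

section TFree

variable (K) in
/-- `J = (x_t : t ∈ T)`. -/
noncomputable abbrev varIdeal (T : Finset (Fin n)) : Ideal (MvPolynomial (Fin n) K) :=
  Ideal.span ((fun i => (X i : MvPolynomial (Fin n) K)) '' (↑T : Set (Fin n)))

/-- The exponent `e` TOUCHES `T`: some `t ∈ T` occurs in `x^e`. -/
def Touches (T : Finset (Fin n)) (e : Fin n →₀ ℕ) : Prop := ∃ t ∈ T, e t ≠ 0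

/-- `Touches T` is decidable. -/
instance decidableTouches (T : Finset (Fin n)) (e : Fin n →₀ ℕ) : Decidable (Touches T e) := by
  unfold Touches; infer_instance

variable (T : Finset (Fin n))

/-- Membership in `J`: every monomial touches `T` (Mathlib's `mem_ideal_span_X_image`). -/
theorem mem_varIdeal_iff {p : MvPolynomial (Fin n) K} : p ∈ varIdeal K T ↔ ∀ e ∈ p.support, Touches T e := by
  rw [varIdeal, mem_ideal_span_X_image]
  simp only [Finset.mem_coe, Touches]

/-- `x_t ∈ J` for `t ∈ T`. -/
theorem X_mem_varIdeal {t : Fin n} (ht : t ∈ T) : (X t : MvPolynomial (Fin n) K) ∈ varIdeal K T :=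
  Ideal.subset_span ⟨t, Finset.mem_coe.2 ht, rfl⟩

/-- A polynomial none of whose monomials touches `T` and which lies in `J` is zero. -/
theorem eq_zero_of_tfree_of_mem {p : MvPolynomial (Fin n) K} (htf : ∀ e ∈ p.support, ¬ Touches T e)
    (hp : p ∈ varIdeal K T) : p = 0 := by
  rw [mem_varIdeal_iff] at hp
  ext e
  rw [coeff_zero]
  by_contra hne
  exact htf e (mem_support_iff.2 hne) (hp e (mem_support_iff.2 hne))

/-- The `T`-FREE PART of `p`: delete the monomials touching `T`. -/
noncomputable def tfreePart (p : MvPolynomial (Fin n) K) : MvPolynomial (Fin n) K :=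
  ∑ e ∈ p.support.filter (fun e => ¬ Touches T e), monomial e (coeff e p)

/-- The coefficients of the `T`-free part. -/
theorem coeff_tfreePart (p : MvPolynomial (Fin n) K) (e : Fin n →₀ ℕ) :
    coeff e (tfreePart T p) = if Touches T e then 0 else coeff e p := by
  classical
  rw [tfreePart, coeff_sum]
  simp_rw [coeff_monomial]
  rw [Finset.sum_ite_eq']
  simp only [Finset.mem_filter, mem_support_iff]
  by_cases h : Touches T e
  · simp [h]
  · by_cases h' : coeff e p = 0 <;> simp [h, h']

/-- The monomials of the `T`-free part do not touch `T`. -/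
theorem not_touches_of_mem_support_tfreePart {p : MvPolynomial (Fin n) K} {e : Fin n →₀ ℕ}
    (h : e ∈ (tfreePart T p).support) : ¬ Touches T e := by
  intro he
  rw [mem_support_iff, coeff_tfreePart, if_pos he] at h
  exact h rfl

/-- `tfreePart T p ≡ p (mod J)`. -/
theorem tfreePart_sub_mem (p : MvPolynomial (Fin n) K) : tfreePart T p - p ∈ varIdeal K T := by
  rw [mem_varIdeal_iff]
  intro e he
  by_contra hne
  rw [mem_support_iff, coeff_sub, coeff_tfreePart, if_neg hne, sub_self] at he
  exact he rfl

/-- `tfreePart T p` and `p` have the same class in `R̄`. -/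
theorem mk_tfreePart (p : MvPolynomial (Fin n) K) :
    Ideal.Quotient.mk (varIdeal K T) (tfreePart T p) = Ideal.Quotient.mk (varIdeal K T) p :=
  (Ideal.Quotient.eq).2 (tfreePart_sub_mem T p)

/-- Every class in `R̄` has a `T`-free representative. -/
theorem exists_tfree_rep (q : MvPolynomial (Fin n) K ⧸ varIdeal K T) :
    ∃ p : MvPolynomial (Fin n) K, (∀ e ∈ p.support, ¬ Touches T e) ∧ Ideal.Quotient.mk (varIdeal K T) p = q := by
  obtain ⟨g, rfl⟩ := Ideal.Quotient.mk_surjective q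
  exact ⟨tfreePart T g, fun e he => not_touches_of_mem_support_tfreePart T he, mk_tfreePart T g⟩

/-! ### Closure properties of `T`-freeness -/

/-- `0` is `T`-free. -/
theorem tfree_zero : ∀ e ∈ (0 : MvPolynomial (Fin n) K).support, ¬ Touches T e := by
  simp

/-- Sums of `T`-free polynomials are `T`-free. -/
theorem tfree_add {p q : MvPolynomial (Fin n) K} (hp : ∀ e ∈ p.support, ¬ Touches T e)
    (hq : ∀ e ∈ q.support, ¬ Touches T e) : ∀ e ∈ (p + q).support, ¬ Touches T e := by
  intro e he
  rcases Finset.mem_union.1 (support_add he) with h | h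
  · exact hp e h
  · exact hq e h

/-- Negatives of `T`-free polynomials are `T`-free. -/
theorem tfree_neg {p : MvPolynomial (Fin n) K} (hp : ∀ e ∈ p.support, ¬ Touches T e) :
    ∀ e ∈ (-p).support, ¬ Touches T e := by
  intro e he
  rw [support_neg] at he
  exact hp e he

/-- Differences of `T`-free polynomials are `T`-free. -/
theorem tfree_sub {p q : MvPolynomial (Fin n) K} (hp : ∀ e ∈ p.support, ¬ Touches T e)
    (hq : ∀ e ∈ q.support, ¬ Touches T e) : ∀ e ∈ (p - q).support, ¬ Touches T e := by
  rw [sub_eq_add_neg]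
  exact tfree_add T hp (tfree_neg T hq)

/-- Finite sums of `T`-free polynomials are `T`-free. -/
theorem tfree_sum {α : Type*} (s : Finset α) (f : α → MvPolynomial (Fin n) K)
    (h : ∀ i ∈ s, ∀ e ∈ (f i).support, ¬ Touches T e) : ∀ e ∈ (∑ i ∈ s, f i).support, ¬ Touches T e :=
  Finset.sum_induction f (fun p => ∀ e ∈ p.support, ¬ Touches T e) (fun _ _ hp hq => tfree_add T hp hq)
    (tfree_zero T) h

/-- Products of `T`-free polynomials are `T`-free. -/
theorem tfree_mul {p q : MvPolynomial (Fin n) K} (hp : ∀ e ∈ p.support, ¬ Touches T e)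
    (hq : ∀ e ∈ q.support, ¬ Touches T e) : ∀ e ∈ (p * q).support, ¬ Touches T e := by
  classical
  intro e he
  obtain ⟨e₁, he₁, e₂, he₂, rfl⟩ := Finset.mem_add.1 (support_mul p q he)
  rintro ⟨t, ht, hne⟩
  rw [Finsupp.coe_add, Pi.add_apply] at hne
  by_cases h₁ : e₁ t = 0
  · exact hq e₂ he₂ ⟨t, ht, by omega⟩
  · exact hp e₁ he₁ ⟨t, ht, h₁⟩

/-- A monomial is `T`-free iff its exponent does not touch `T`. -/
theorem tfree_monomial {d : Fin n →₀ ℕ} (hd : ¬ Touches T d) (c : K) :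
    ∀ e ∈ (monomial d c : MvPolynomial (Fin n) K).support, ¬ Touches T e := by
  classical
  intro e he
  rw [Finset.mem_singleton.1 (support_monomial_subset he)]
  exact hd

/-- `x_b` is `T`-free for `b ∉ T`. -/
theorem tfree_X {b : Fin n} (hb : b ∉ T) : ∀ e ∈ (X b : MvPolynomial (Fin n) K).support, ¬ Touches T e := by
  rw [X, show (Finsupp.single b 1 : Fin n →₀ ℕ) = Finsupp.single b 1 from rfl]
  refine tfree_monomial T ?_ 1
  rintro ⟨t, ht, hne⟩
  rw [Finsupp.single_apply] at hne
  split_ifs at hne with h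
  · exact hb (h ▸ ht)
  · exact hne rfl

/-- `x_U` is `T`-free for `U ∩ T = ∅`. -/
theorem tfree_sq {U : Finset (Fin n)} (hU : ∀ u ∈ U, u ∉ T) :
    ∀ e ∈ (sq U : MvPolynomial (Fin n) K).support, ¬ Touches T e := by
  rw [sq_eq_monomial]
  refine tfree_monomial T ?_ 1
  rintro ⟨t, ht, hne⟩
  exact hne (ind_apply_of_notMem fun h => hU t h ht)

/-! ### Non-zero-divisors modulo `J` -/

/-- **`x_U` is a non-zero-divisor modulo `J`** for `U ∩ T = ∅`: `x_U · p ∈ J ⟺ p ∈ J`. -/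
theorem sq_mul_mem_varIdeal_iff {U : Finset (Fin n)} (hU : ∀ u ∈ U, u ∉ T) (p : MvPolynomial (Fin n) K) :
    sq U * p ∈ varIdeal K T ↔ p ∈ varIdeal K T := by
  constructor
  · intro h
    rw [mem_varIdeal_iff] at h ⊢
    intro e he
    obtain ⟨t, ht, hne⟩ := h _ (add_mem_support_sq_mul he)
    refine ⟨t, ht, ?_⟩
    rw [Finsupp.coe_add, Pi.add_apply, ind_apply_of_notMem (fun h' => hU t h' ht), add_zero] at hne
    exact hne
  · intro h
    exact Ideal.mul_mem_left _ _ h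

/-- `x_U •` is injective on `R̄` for `U ∩ T = ∅`. -/
theorem sq_smul_quot_injective {U : Finset (Fin n)} (hU : ∀ u ∈ U, u ∉ T) :
    Function.Injective fun q : MvPolynomial (Fin n) K ⧸ varIdeal K T => (sq U : MvPolynomial (Fin n) K) • q := by
  have h0 : ∀ q : MvPolynomial (Fin n) K ⧸ varIdeal K T, (sq U : MvPolynomial (Fin n) K) • q = 0 → q = 0 := by
    intro q hq
    obtain ⟨g, rfl⟩ := Ideal.Quotient.mk_surjective q
    rw [smul_mk_eq, Ideal.Quotient.eq_zero_iff_mem, sq_mul_mem_varIdeal_iff T hU] at hq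
    exact Ideal.Quotient.eq_zero_iff_mem.2 hq
  intro q q' h
  have : (sq U : MvPolynomial (Fin n) K) • (q - q') = 0 := by
    rw [smul_sub, sub_eq_zero]; exact h
  exact sub_eq_zero.1 (h0 _ this)

/-- `x_b •` is injective on `R̄` for `b ∉ T`. -/
theorem X_smul_quot_injective {b : Fin n} (hb : b ∉ T) :
    Function.Injective fun q : MvPolynomial (Fin n) K ⧸ varIdeal K T => (X b : MvPolynomial (Fin n) K) • q := by
  have : (X b : MvPolynomial (Fin n) K) = sq {b} := by rw [sq, Finset.prod_singleton]
  rw [this]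
  exact sq_smul_quot_injective T (fun u hu => by rw [Finset.mem_singleton.1 hu]; exact hb)

end TFree

/-! ## The Hilbert–Burch matrix on vectors with values in a module with injective `x_a`-action -/

section HBInjective

variable (S : Finset (Fin n)) (a₀ : Fin n) {M : Type u} [AddCommGroup M] [Module (MvPolynomial (Fin n) K) M]

/-- **`Φ` is injective on `M`-valued vectors as soon as every `x_a`, `a ∈ S ∖ a₀`, acts injectively on `M`**
(row `a ≠ a₀` of `Φ w` is `x_a w_a`). -/
theorem scalarMatrix_hbMatrix_injective_of_smul_injective
    (hM : ∀ a ∈ S, a ≠ a₀ → Function.Injective fun m : M => (X a : MvPolynomial (Fin n) K) • m) :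
    Function.Injective (scalarMatrix M (hbMatrix (K := K) S a₀)) := by
  intro w w' h
  funext b
  have hb : (b : Fin n) ≠ a₀ := (Finset.mem_erase.1 b.2).1
  have hbS : (b : Fin n) ∈ S := Finset.mem_of_mem_erase b.2
  have := congr_fun h ⟨b.1, hbS⟩
  rw [scalarMatrix_hbMatrix_apply_of_ne S a₀ w _ hb, scalarMatrix_hbMatrix_apply_of_ne S a₀ w' _ hb] at this
  have hb' : (⟨(b : Fin n), Finset.mem_erase.2 ⟨hb, hbS⟩⟩ : ↥(S.erase a₀)) = b := Subtype.ext rfl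
  rw [hb'] at this
  exact hM b.1 hbS hb this

/-- Injective scalar actions pass to products. -/
theorem X_smul_pi_injective {τ : Type} (Q : τ → Type u) [∀ t, AddCommGroup (Q t)]
    [∀ t, Module (MvPolynomial (Fin n) K) (Q t)] (r : MvPolynomial (Fin n) K)
    (h : ∀ t, Function.Injective fun m : Q t => r • m) :
    Function.Injective fun m : ((t : τ) → Q t) => r • m := by
  intro m m' hmm'
  funext t
  exact h t (by simpa using congr_fun hmm' t)

end HBInjective

end Summit.Ventures.HSemireg.ObstructionLocus.BlockModel
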